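import Mathlib
import Summits.MatrixMultiplication.Statement
import Literature.Computability.AlgebraicComplexity.FlatteningBound
import Literature.Computability.AlgebraicComplexity.NonscalarComputation
import Literature.Computability.AlgebraicComplexity.NonscalarBilinearRank
import Summits.MatrixMultiplication.MatrixMultiplication.Theorems.GraphEquationsSystems
import Summits.MatrixMultiplication.MatrixMultiplication.Theorems.GraphEquationsKernel
import Summits.MatrixMultiplication.MatrixMultiplication.Theorems.GraphEquationsCostRank
import Summits.MatrixMultiplication.MatrixMultiplication.Theorems.GraphEquationsCoeffIdentity

/-!
# GraphEquations — the OSCULATING cost–rank core (M18a, decomp-mm-lens-5 g31)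

(supports `MultiplicityReduction`, stmt-MatrixMultiplication-27806, hand 1 = BOP′ at `K = 2`.)

Module 4/4 (`GraphEquationsCostRank`, `tensorRank_le_of_vanishing`) is Strassen's truncation at a
REDUCED point: polynomials `p_o` vanishing on the graph `W_n`, in the cost-free span of one nonscalar
sequence of length `≤ N`, with linear `C`-coefficient matrix of FULL column rank `n²`, force
`R(⟨n,n,n⟩) ≤ 2N`.  Vanishing on `W_n` enters only through the coefficient identity
`coeff_{a_ij b_j'l}(p_o) = −[j = j']·coeff_{c_il}(p_o)`.

This module proves the same conclusion from a strictly WEAKER, purely coefficient-level hypothesis —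
the **osculating coefficient identity**

  `coeff_{a_ij b_j'l}(p_o) = −[j = j']·J(o,(i,l)) − Σ_r H(o,r)·M(r;(i,j),(j',l))`

with `J` the linear `C`-coefficient matrix of the `p_o`, an arbitrary ERROR matrix `H` and an
arbitrary bilinear ERROR tensor `M` — together with a matrix `P` that is a left inverse of `J`
ANNIHILATING the error columns (`P J = 1`, `P H = 0`).  Such a `P` exists iff
`{p : J p ∈ colspace H} = 0` (`exists_leftInverse_annihilating`, rank–nullity on the quotient by
`colspace H`).  No polynomial is required to vanish on `W_n`: the `p_o` need only OSCULATE the graph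
to second order in the `a ⊗ b`-directions modulo the error columns.  This is exactly the situation of
a Leykin–Verschelde–Zhao deflation step read in Ostrowski's model (module M18c): the deflated tests
`D_ξ t_o` along an affine kernel 2-jet `ξ` do NOT vanish on `W_n`, but their `a ⊗ b`-coefficients are
correct modulo the column space of the OLD Jacobian — and that is all the truncation needs.

Main results (no `sorry`):
* `exists_leftInverse_annihilating` — `(∀ p ν, J p = H ν → p = 0) → ∃ P, P J = 1 ∧ P H = 0`.
* `tensorRank_le_of_oscId` — the osculating system-free core: `R(⟨n,n,n⟩) ≤ 2N`.
* `tensorRank_le_of_vanishing'` — module 4/4's core is the special case `H = 0` (sanity check that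
  the new hypothesis is WEAKER, via `coeffIdentity`).

Sources: [BurgisserClausenShokrollahi1997, Prop. (14.1), (14.8), §15.1]; [Strassen1973];
[LeykinVerscheldeZhao2006, Thm. 3.1] (deflation with the kernel direction as unknowns);
[HauensteinWampler2013] (isosingular deflation).
-/

set_option linter.dupNamespace false

noncomputable section

open scoped BigOperators

namespace Summit.MatrixMultiplication.MatrixMultiplication.Theorems.GraphEquations

open MvPolynomial
open Literature.Computability.AlgebraicComplexity
open Literature.Computability.AlgebraicComplexity.ArithCircuit

/-! ## Linear algebra: a left inverse annihilating prescribed columns -/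

/-- **Left inverse annihilating the error columns.**  If `J p = H ν` forces `p = 0`, then some
`P` satisfies `P J = 1` and `P H = 0` (the map `p ↦ J p mod colspace H` is injective, hence has a
left inverse on the quotient). -/
theorem exists_leftInverse_annihilating {ο Q R : Type*} [Fintype ο] [Fintype Q] [Fintype R]
    [DecidableEq ο] [DecidableEq Q] [DecidableEq R]
    (J : Matrix ο Q ℂ) (H : Matrix ο R ℂ)
    (hreg : ∀ (p : Q → ℂ) (ν : R → ℂ), J.mulVec p = H.mulVec ν → p = 0) :
    ∃ P : Matrix Q ο ℂ, P * J = 1 ∧ P * H = 0 := by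
  classical
  set U : Submodule ℂ (ο → ℂ) := LinearMap.range (Matrix.toLin' H) with hU
  set φ : (Q → ℂ) →ₗ[ℂ] (ο → ℂ) ⧸ U := U.mkQ.comp (Matrix.toLin' J) with hφ
  have hker : LinearMap.ker φ = ⊥ := by
    rw [LinearMap.ker_eq_bot']
    intro p hp
    have hp' : Matrix.toLin' J p ∈ U := by
      simpa [hφ, Submodule.Quotient.mk_eq_zero] using hp
    obtain ⟨ν, hν⟩ := LinearMap.mem_range.mp hp'
    refine hreg p ν ?_
    rw [← Matrix.toLin'_apply, ← Matrix.toLin'_apply, hν]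
  obtain ⟨g, hg⟩ := LinearMap.exists_leftInverse_of_injective φ hker
  refine ⟨LinearMap.toMatrix' (g.comp U.mkQ), ?_, ?_⟩
  · have h1 : (g.comp U.mkQ).comp (Matrix.toLin' J) = LinearMap.id := by
      rw [LinearMap.comp_assoc]; exact hg
    have := congrArg LinearMap.toMatrix' h1
    rwa [LinearMap.toMatrix'_comp, LinearMap.toMatrix'_toLin', LinearMap.toMatrix'_id] at this
  · have h2 : (g.comp U.mkQ).comp (Matrix.toLin' H) = 0 := by
      apply LinearMap.ext
      intro ν
      have hmem : Matrix.toLin' H ν ∈ U := LinearMap.mem_range_self _ ν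
      simp only [LinearMap.comp_apply, LinearMap.zero_apply, Submodule.mkQ_apply]
      rw [(Submodule.Quotient.mk_eq_zero U).mpr hmem, map_zero]
    have := congrArg LinearMap.toMatrix' h2
    rwa [LinearMap.toMatrix'_comp, LinearMap.toMatrix'_toLin', map_zero] at this

/-! ## The osculating system-free core -/

/-- **Osculating system-free core.**  Let `p_o` (`o ∈ ο`) be polynomials in `ℂ[A,B,C]` lying in the
cost-free span of one nonscalar sequence of length `≤ N`, and suppose the OSCULATING COEFFICIENT
IDENTITY `coeff_{a_ij b_j'l}(p_o) = −[j = j']·coeff_{c_il}(p_o) − Σ_r H(o,r)·M(r;(i,j),(j',l))` holds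
for some error matrix `H` and bilinear error `M`.  If a matrix `P` is a left inverse of the linear
`C`-coefficient matrix of the `p_o` and annihilates `H`, then `R(⟨n,n,n⟩) ≤ 2N`. -/
theorem tensorRank_le_of_oscId {n N : ℕ} {ο R : Type*} [Fintype ο] [Fintype R] [DecidableEq ο]
    (p : ο → MvPolynomial (GraphVars n) ℂ)
    (hspan : ∃ gs : List (MvPolynomial (GraphVars n) ℂ), IsNonscalarSeq gs ∧ gs.length ≤ N ∧
      ∀ o, p o ∈ freeSpan {q | q ∈ gs})
    (H : ο → R → ℂ) (M : R → Fin n × Fin n → Fin n × Fin n → ℂ)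
    (hosc : ∀ o (i j j' l : Fin n),
      coeff (Finsupp.single (Sum.inl (Sum.inl (i, j)) : GraphVars n) 1 +
          Finsupp.single (Sum.inl (Sum.inr (j', l)) : GraphVars n) 1) (p o) =
        -(if j = j' then coeff (Finsupp.single (Sum.inr (i, l) : GraphVars n) 1) (p o) else 0) -
          ∑ r, H o r * M r (i, j) (j', l))
    (P : Fin n × Fin n → ο → ℂ)
    (hPJ : ∀ c q, ∑ o, P c o * coeff (Finsupp.single (Sum.inr q : GraphVars n) 1) (p o) =
      if c = q then 1 else 0)
    (hPH : ∀ c r, ∑ o, P c o * H o r = 0) :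
    tensorRank (matMulTensor ℂ n n n) ≤ 2 * N := by
  classical
  obtain ⟨r, hr, w, u, v, hwuv⟩ := exists_triads_of_isNonscalarSeq
    (fun a : Fin n × Fin n => (Sum.inl (Sum.inl a) : GraphVars n))
    (fun b : Fin n × Fin n => (Sum.inl (Sum.inr b) : GraphVars n))
    (fun a b h => by simp at h) p hspan
  refine le_trans (tensorRank_le_of_eq_sum (fun ρ c => -∑ o, P c o * w ρ o) u v ?_) hr
  funext c a b
  obtain ⟨i, j⟩ := a
  obtain ⟨j', l⟩ := b
  have key : ∀ o, ∑ ρ, w ρ o * u ρ (i, j) * v ρ (j', l) =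
      -(if j = j' then coeff (Finsupp.single (Sum.inr (i, l) : GraphVars n) 1) (p o) else 0) -
        ∑ r, H o r * M r (i, j) (j', l) := by
    intro o; rw [hwuv]; exact hosc o i j j' l
  have hsum : ∑ ρ, (-∑ o, P c o * w ρ o) * u ρ (i, j) * v ρ (j', l) =
      -∑ o, P c o * ∑ ρ, w ρ o * u ρ (i, j) * v ρ (j', l) := by
    simp only [neg_mul, Finset.sum_neg_distrib, Finset.sum_mul, Finset.mul_sum]
    rw [Finset.sum_comm]
    congr 1
    refine Finset.sum_congr rfl fun o _ => Finset.sum_congr rfl fun ρ _ => by ring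
  -- the error term dies under `P`
  have herr : ∑ o, P c o * ∑ r, H o r * M r (i, j) (j', l) = 0 := by
    calc ∑ o, P c o * ∑ r, H o r * M r (i, j) (j', l)
        = ∑ r, (∑ o, P c o * H o r) * M r (i, j) (j', l) := by
          simp only [Finset.mul_sum, Finset.sum_mul]
          rw [Finset.sum_comm]
          exact Finset.sum_congr rfl fun r _ => Finset.sum_congr rfl fun o _ => by ring
      _ = 0 := by simp [hPH]
  simp only [Finset.sum_apply, triad_apply]
  rw [hsum]
  simp_rw [key]
  have hsplit : ∑ o, P c o *
      (-(if j = j' then coeff (Finsupp.single (Sum.inr (i, l) : GraphVars n) 1) (p o) else 0) -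
        ∑ r, H o r * M r (i, j) (j', l)) =
      -(∑ o, P c o *
        (if j = j' then coeff (Finsupp.single (Sum.inr (i, l) : GraphVars n) 1) (p o) else 0)) -
        ∑ o, P c o * ∑ r, H o r * M r (i, j) (j', l) := by
    rw [← Finset.sum_neg_distrib, ← Finset.sum_sub_distrib]
    exact Finset.sum_congr rfl fun o _ => by ring
  rw [hsplit, herr, sub_zero, neg_neg]
  by_cases hjj : j = j'
  · subst hjj
    simp only [if_true, hPJ]
    obtain ⟨c1, c2⟩ := c
    simp [matMulTensor, Prod.ext_iff]
  · simp [matMulTensor, hjj]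

/-- Sanity check: module 4/4's core is the special case `H = 0` of the osculating core (so the new
hypothesis is weaker).  Uses the tree's theorem `coeffIdentity`. -/
theorem tensorRank_le_of_vanishing' {n T N : ℕ} (p : Fin T → MvPolynomial (GraphVars n) ℂ)
    (hvan : ∀ o, ∀ x ∈ mmGraph n, eval x (p o) = 0)
    (hspan : ∃ gs : List (MvPolynomial (GraphVars n) ℂ), IsNonscalarSeq gs ∧ gs.length ≤ N ∧
      ∀ o, p o ∈ freeSpan {q | q ∈ gs})
    (hrank : (linCoeffC p).rank = n * n) :
    tensorRank (matMulTensor ℂ n n n) ≤ 2 * N := by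
  classical
  obtain ⟨P, hPJ⟩ := leftInverse_of_rank_eq (linCoeffC p) hrank
  refine tensorRank_le_of_oscId p hspan (fun _ (_ : Fin 0) => 0) (fun _ _ _ => 0)
    (fun o i j j' l => ?_) P (fun c q => ?_) (fun c r => by simp)
  · rw [coeffIdentity n (p o) (hvan o) i j j' l]; simp
  · have := congrFun (congrFun hPJ c) q
    simpa [Matrix.mul_apply, Matrix.one_apply, linCoeffC] using this

end Summit.MatrixMultiplication.MatrixMultiplication.Theorems.GraphEquations

end
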